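import Summits.QuantumFields.YangMills.Theorems.BalabanUVNodesN21CollarJunctionAtBlockFibreLaw
import Summits.QuantumFields.YangMills.Theorems.BalabanUVNodesN21ShellSplitOfRecord13CoPHStat

/-!
# N21 (NE7c) · THE COLLAR JUNCTION AT THE RECORD's BLOCK FIBRE LAWS, KEYED: dag-n21-d's END
# `shellWeightBound_crOfRecord₁₃At_shellSplit_of_blockFibreAC` with its one displayed estimate discharged from
# per-exterior-field block charts and (M1) on comparable frame laws

R141 (C) seat pub-ymgap-dag-n21-e (g19), node N21 = NE7c (NOT PRINTED in [Bałaban 1983–89], NOT proved), strategy s3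
ALTERNATIVE CURRENCY, lane K3⁷ `SpineGivenEndpointR13SepCoPH` (stmt-QuantumFields-20544, `--kind proof --supports …
--as helper`).  Part 38t′ — sibling of 38t `…N21CollarJunctionAtBlockFibreLaw`; consumes BY NAME dag-n21-d g9's FILE 6
`…N21ShellSplitOfRecord13CoPHStat` ★★★★ `shellWeightBound_crOfRecord₁₃At_shellSplit_of_blockFibreAC` (THE END of the
shell split of record on the live-selector line) and 38t ★ `fibreAC_of_chart_dominated`.

WHAT THIS FILE PROVES (one theorem, 0 `def`, 0 `sorry`).  ★★ `shellWeightBound_crOfRecord₁₃At_shellSplit_of_fibreCharts`: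
`ShellWeightBound` AT `crOfRecord₁₃At K₀ jcut (shellSplitOfRecord₁₃At N K₀ ρA ρB)` (carriers + canonical `Wsh`) on the
live-selector line FROM: n20-d's extraction rows (`hsel`, (H-U), (H-ζ), `0 ≤ ζ`), the width letters' signs, constants
`0 ≤ D_K` with `Σ_K D_K ρ_K < ∞` per run, two UNIFORM ratios `M₁, M₂ ≥ 0`, and — replacing dag-n21-d's one displayed
estimate — per (run, K, t, top cube a, exterior field x): a block chart `Φ` of `↥(inputBlock a) → SU N` into one frame
`Y`, a frame statistic `U` through which the exterior-free block reading of the cube statistic of record factors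
(`blockReading N (cubeStat a) (inputBlock a) 1 = U ∘ Φ`), a frame law `ν'`, the two-ratio dictionary (`hS`, `hmass`), and
(M1) `SlotAntiConcentration ν' U ε_k ρ_K D_K` FOR THE FRAME LAW (`|t| ≤ 1`).  The constant of record becomes
`D_K·(M₁·M₂)`.  So the N21 wall at the record, read through 38t, is: per frozen exterior field, (M1) for a frame law
COMPARABLE through a chart to the explicit block fibre law on `(SU N)^{inputBlock a}` — the shape the collar ENDs (38t
★★★), the dilation ∕ centre ENDs (dag-n21-d parts 28 ∕ 31 ∕ 34) and dag-n21-w1's chart letters conclude on their frames.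

BINDERS LEFT (displayed; other lanes' objects, none asserted): the charts, frame laws and two-ratio dictionaries (the
frozen-exterior (2.18) block density in a chart vs a model density — NODE O's term object; Haar's radial Jacobian =
dag-n21-d part 24), the reading identities, (M1) on the frame laws, the extraction rows.  A6 said plainly: `ρ ≡ 0`,
`D ≡ 0` is the junk instance; nothing inhabited here (the collar frame's binders are inhabited in 38m′ ∕ 38r′).

HONEST FRAMING.  [textbook] by-name composition; nothing of Bałaban's asserted; (M1) NOT PRINTED ∕ NOT proved; NE7c NOT
proved; N21 NOT discharged; K3⁷ NOT claimed; no `Provisos₁₃CoPH` inhabitant claimed (K0⁷ open); counts unmoved (typed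
28∕28 · discharged 5∕27); count-neutral; one finite 𝕋⁴ at fixed ε — nothing about ℝ⁴ ∕ OS ∕ mass gap ∕ Clay.
-/

set_option autoImplicit false

open MeasureTheory Set Function
open scoped ENNReal BigOperators

namespace Summit.QuantumFields.YangMills.Theorems.N21CollarJunctionAtCubeLaw

open Literature.MathematicalPhysics.QuantumFieldTheory.Balaban1983to89
open Literature.MathematicalPhysics.QuantumFieldTheory.Balaban1983to89.T4Continuum
open Literature.MathematicalPhysics.QuantumFieldTheory.Balaban1983to89.Node00
open Literature.MathematicalPhysics.QuantumFieldTheory.Balaban1983to89.T4ShellMeasure (SlotAntiConcentration)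
open Literature.MathematicalPhysics.QuantumFieldTheory.Balaban1983to89.T4IndicatorShell (ShellWeightBound)
open YMDAG.UVSplit (crOfRecord₁₃At runA₁₃ runB₁₃ histA₁₃ histB₁₃)
open Summit.QuantumFields.YangMills.Theorems.N21ShellSplitOfRecord13CoPH

/-! ## §1 The keyed END from per-exterior-field block charts -/

section AtRecord

variable {F : T4Family} {N : ℕ} [NeZero N]

/-- **★★ N21's END AT THE RECORD FROM PER-EXTERIOR-FIELD BLOCK CHARTS.**  dag-n21-d's ★★★★
`shellWeightBound_crOfRecord₁₃At_shellSplit_of_blockFibreAC` with its one displayed estimate — (M1) for the block fibre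
law of record at every (run, K, `|t| ≤ 1`, top cube, exterior field) — DISCHARGED by 38t ★ `fibreAC_of_chart_dominated`
from a chart of `↥(inputBlock a) → SU N` into one frame `Y`, a frame statistic factoring the exterior-free block reading
of `cubeStat a`, a frame law with (M1) (constant `D_K`), and the two-ratio dictionary with UNIFORM ratios `M₁, M₂`; the
END's constants are `D_K·(M₁·M₂)` (summable with `D_K ρ_K`). [textbook] -/
theorem shellWeightBound_crOfRecord₁₃At_shellSplit_of_fibreCharts (K₀ : ℕ) (jcut : ℕ → ℕ)
    (ρA ρB : WidthLetter₁₃CoPH N) (θ : Stage13HParams F N) (hP : θ.Provisos₁₃CoPH F N) (g₀ : ℕ → ℝ)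
    (os : List (ULoop F)) (E : B12.RunParams → ℝ)
    (hsel : θ.ppSel = ppSelLiveOfRecord F N θ.ν θ.τ9 E (wOfRecord₉ F N θ.toStage9Params))
    (hU : LocalBgMeasurable F N θ.ν) (hζm : ZetaMeasurable F N θ.ζ)
    (hζ0 : ∀ p g k s Pl Ql RS U V', 0 ≤ θ.ζ p g k s Pl Ql RS U V')
    {DA DB : ℕ → ℝ} (hρA : ∀ K, 0 ≤ ρA F θ hP g₀ os K) (hDA : ∀ K, 0 ≤ DA K) (hρB : ∀ K, 0 ≤ ρB F θ hP g₀ os K)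
    (hDB : ∀ K, 0 ≤ DB K)
    (hsA : Summable (fun K => DA K * ρA F θ hP g₀ os K)) (hsB : Summable (fun K => DB K * ρB F θ hP g₀ os K))
    {M₁ M₂ : ℝ} (hM₁ : 0 ≤ M₁) (hM₂ : 0 ≤ M₂)
    -- the frame, the charts, the frame statistics with their reading identities, the frame laws and their dictionaries
    {Y : Type*} [MeasurableSpace Y]
    (ΦA : ∀ (K : ℕ) (t : ℝ) (a : ↥(cubeIndices (F.P (K₀ + K)) (cubeSide (F.P (K₀ + K)).L θ.ν.M₂
        (RkOfRecord (F.P (K₀ + K)).L θ.ν.r (histA₁₃ θ K₀ g₀ K (K₀ + K))) (K₀ + K))))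
        (x : GaugeField (F.P (K₀ + K)) (K₀ + K) (SU N)), (↥(inputBlock F θ.ν (histA₁₃ θ K₀ g₀ K) a) → SU N) → Y)
    (UA : ∀ (K : ℕ) (t : ℝ) (a : ↥(cubeIndices (F.P (K₀ + K)) (cubeSide (F.P (K₀ + K)).L θ.ν.M₂
        (RkOfRecord (F.P (K₀ + K)).L θ.ν.r (histA₁₃ θ K₀ g₀ K (K₀ + K))) (K₀ + K))))
        (x : GaugeField (F.P (K₀ + K)) (K₀ + K) (SU N)), Y → ℝ)
    (hreadA : ∀ K t a x y,
      blockReading N (cubeStat F N θ.ν (histA₁₃ θ K₀ g₀ K) (Kc := K₀ + K) (k := K₀ + K) a)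
        (inputBlock F θ.ν (histA₁₃ θ K₀ g₀ K) a) (fun _ => 1) y = UA K t a x (ΦA K t a x y))
    (νA : ∀ (K : ℕ) (t : ℝ) (a : ↥(cubeIndices (F.P (K₀ + K)) (cubeSide (F.P (K₀ + K)).L θ.ν.M₂
        (RkOfRecord (F.P (K₀ + K)).L θ.ν.r (histA₁₃ θ K₀ g₀ K (K₀ + K))) (K₀ + K))))
        (x : GaugeField (F.P (K₀ + K)) (K₀ + K) (SU N)), Measure Y)
    (hSA : ∀ K t a x,
      blockFibreLawOfDatum₉ F N θ.toStage9Params (datumOfRecord₁₃CoPH F N θ hP) g₀ os (runA₁₃ F K₀ g₀ K)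
          (histA₁₃ θ K₀ g₀ K) (K₀ + K) t a (inputBlock F θ.ν (histA₁₃ θ K₀ g₀ K) a) x
          {y | epsOfRecord θ.ν (histA₁₃ θ K₀ g₀ K) (K₀ + K) * (1 - ρA F θ hP g₀ os K) ≤ UA K t a x (ΦA K t a x y) ∧
            UA K t a x (ΦA K t a x y) < epsOfRecord θ.ν (histA₁₃ θ K₀ g₀ K) (K₀ + K)} ≤
        ENNReal.ofReal M₁ * νA K t a x
          {y | epsOfRecord θ.ν (histA₁₃ θ K₀ g₀ K) (K₀ + K) * (1 - ρA F θ hP g₀ os K) ≤ UA K t a x y ∧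
            UA K t a x y < epsOfRecord θ.ν (histA₁₃ θ K₀ g₀ K) (K₀ + K)})
    (hmassA : ∀ K t a x, νA K t a x univ ≤
      ENNReal.ofReal M₂ * blockFibreLawOfDatum₉ F N θ.toStage9Params (datumOfRecord₁₃CoPH F N θ hP) g₀ os
        (runA₁₃ F K₀ g₀ K) (histA₁₃ θ K₀ g₀ K) (K₀ + K) t a (inputBlock F θ.ν (histA₁₃ θ K₀ g₀ K) a) x univ)
    (hACA : ∀ (K : ℕ) (t : ℝ), |t| ≤ 1 → ∀ a x,
      SlotAntiConcentration (νA K t a x) (UA K t a x) (epsOfRecord θ.ν (histA₁₃ θ K₀ g₀ K) (K₀ + K))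
        (ρA F θ hP g₀ os K) (DA K))
    (ΦB : ∀ (K : ℕ) (t : ℝ) (a : ↥(cubeIndices (F.P (K₀ + K + 1)) (cubeSide (F.P (K₀ + K + 1)).L θ.ν.M₂
        (RkOfRecord (F.P (K₀ + K + 1)).L θ.ν.r (histB₁₃ θ K₀ g₀ K (K₀ + K + 1))) (K₀ + K + 1))))
        (x : GaugeField (F.P (K₀ + K + 1)) (K₀ + K + 1) (SU N)),
        (↥(inputBlock F θ.ν (histB₁₃ θ K₀ g₀ K) a) → SU N) → Y)
    (UB : ∀ (K : ℕ) (t : ℝ) (a : ↥(cubeIndices (F.P (K₀ + K + 1)) (cubeSide (F.P (K₀ + K + 1)).L θ.ν.M₂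
        (RkOfRecord (F.P (K₀ + K + 1)).L θ.ν.r (histB₁₃ θ K₀ g₀ K (K₀ + K + 1))) (K₀ + K + 1))))
        (x : GaugeField (F.P (K₀ + K + 1)) (K₀ + K + 1) (SU N)), Y → ℝ)
    (hreadB : ∀ K t a x y,
      blockReading N (cubeStat F N θ.ν (histB₁₃ θ K₀ g₀ K) (Kc := K₀ + K + 1) (k := K₀ + K + 1) a)
        (inputBlock F θ.ν (histB₁₃ θ K₀ g₀ K) a) (fun _ => 1) y = UB K t a x (ΦB K t a x y))
    (νB : ∀ (K : ℕ) (t : ℝ) (a : ↥(cubeIndices (F.P (K₀ + K + 1)) (cubeSide (F.P (K₀ + K + 1)).L θ.ν.M₂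
        (RkOfRecord (F.P (K₀ + K + 1)).L θ.ν.r (histB₁₃ θ K₀ g₀ K (K₀ + K + 1))) (K₀ + K + 1))))
        (x : GaugeField (F.P (K₀ + K + 1)) (K₀ + K + 1) (SU N)), Measure Y)
    (hSB : ∀ K t a x,
      blockFibreLawOfDatum₉ F N θ.toStage9Params (datumOfRecord₁₃CoPH F N θ hP) g₀ os (runB₁₃ F K₀ g₀ K)
          (histB₁₃ θ K₀ g₀ K) (K₀ + K + 1) t a (inputBlock F θ.ν (histB₁₃ θ K₀ g₀ K) a) x
          {y | epsOfRecord θ.ν (histB₁₃ θ K₀ g₀ K) (K₀ + K + 1) * (1 - ρB F θ hP g₀ os K) ≤ UB K t a x (ΦB K t a x y) ∧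
            UB K t a x (ΦB K t a x y) < epsOfRecord θ.ν (histB₁₃ θ K₀ g₀ K) (K₀ + K + 1)} ≤
        ENNReal.ofReal M₁ * νB K t a x
          {y | epsOfRecord θ.ν (histB₁₃ θ K₀ g₀ K) (K₀ + K + 1) * (1 - ρB F θ hP g₀ os K) ≤ UB K t a x y ∧
            UB K t a x y < epsOfRecord θ.ν (histB₁₃ θ K₀ g₀ K) (K₀ + K + 1)})
    (hmassB : ∀ K t a x, νB K t a x univ ≤
      ENNReal.ofReal M₂ * blockFibreLawOfDatum₉ F N θ.toStage9Params (datumOfRecord₁₃CoPH F N θ hP) g₀ os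
        (runB₁₃ F K₀ g₀ K) (histB₁₃ θ K₀ g₀ K) (K₀ + K + 1) t a (inputBlock F θ.ν (histB₁₃ θ K₀ g₀ K) a) x univ)
    (hACB : ∀ (K : ℕ) (t : ℝ), |t| ≤ 1 → ∀ a x,
      SlotAntiConcentration (νB K t a x) (UB K t a x) (epsOfRecord θ.ν (histB₁₃ θ K₀ g₀ K) (K₀ + K + 1))
        (ρB F θ hP g₀ os K) (DB K)) :
    ShellWeightBound (crOfRecord₁₃At K₀ jcut (shellSplitOfRecord₁₃At N K₀ ρA ρB) F θ hP g₀ os).l₀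
      (crOfRecord₁₃At K₀ jcut (shellSplitOfRecord₁₃At N K₀ ρA ρB) F θ hP g₀ os).T
      (crOfRecord₁₃At K₀ jcut (shellSplitOfRecord₁₃At N K₀ ρA ρB) F θ hP g₀ os).A
      (crOfRecord₁₃At K₀ jcut (shellSplitOfRecord₁₃At N K₀ ρA ρB) F θ hP g₀ os).B
      (crOfRecord₁₃At K₀ jcut (shellSplitOfRecord₁₃At N K₀ ρA ρB) F θ hP g₀ os).shA
      (crOfRecord₁₃At K₀ jcut (shellSplitOfRecord₁₃At N K₀ ρA ρB) F θ hP g₀ os).shB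
      (crOfRecord₁₃At K₀ jcut (shellSplitOfRecord₁₃At N K₀ ρA ρB) F θ hP g₀ os).Wsh := by
  refine shellWeightBound_crOfRecord₁₃At_shellSplit_of_blockFibreAC K₀ jcut ρA ρB θ hP g₀ os E hsel hU hζm hζ0
    (DA := fun K => DA K * (M₁ * M₂)) (DB := fun K => DB K * (M₁ * M₂)) hρA
    (fun K => mul_nonneg (hDA K) (mul_nonneg hM₁ hM₂)) hρB (fun K => mul_nonneg (hDB K) (mul_nonneg hM₁ hM₂))
    ((hsA.mul_left (M₁ * M₂)).congr fun K => by ring) ((hsB.mul_left (M₁ * M₂)).congr fun K => by ring)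
    (fun K t ht a x => ?_) (fun K t ht a x => ?_)
  · exact fibreAC_of_chart_dominated F N θ.toStage9Params (datumOfRecord₁₃CoPH F N θ hP) g₀ os (runA₁₃ F K₀ g₀ K)
      (histA₁₃ θ K₀ g₀ K) (K₀ + K) t a (inputBlock F θ.ν (histA₁₃ θ K₀ g₀ K) a) x _ (ΦA K t a x) (UA K t a x)
      (hreadA K t a x) (νA K t a x) (hDA K) (hρA K) hM₁ (hSA K t a x) (hmassA K t a x) (hACA K t ht a x)
  · exact fibreAC_of_chart_dominated F N θ.toStage9Params (datumOfRecord₁₃CoPH F N θ hP) g₀ os (runB₁₃ F K₀ g₀ K)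
      (histB₁₃ θ K₀ g₀ K) (K₀ + K + 1) t a (inputBlock F θ.ν (histB₁₃ θ K₀ g₀ K) a) x _ (ΦB K t a x) (UB K t a x)
      (hreadB K t a x) (νB K t a x) (hDB K) (hρB K) hM₁ (hSB K t a x) (hmassB K t a x) (hACB K t ht a x)

end AtRecord

end Summit.QuantumFields.YangMills.Theorems.N21CollarJunctionAtCubeLaw
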